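import Literature.Probability.RandomPlanarGeometry.SAWBrickWallHex
import HarnessLib

/-!
# Decoding the staggered double-brick join on the honeycomb lattice: the staggered cut of an equal-split merge is unique

Topic `Literature/Probability/RandomPlanarGeometry` (lane «pcv-sawmu», a-p4 g13; sequel of TREE `HexSAWPolygonJoinDecode.lean` (a-p4 g12:
`HexBW.IsBrickCut`, `isBrickCut_unique` — the ONE-brick junction)).

Context.  In the capless Madras join on the brick wall `ℍ` (N. Madras, J. Stat. Phys. 78 (1995) §2; A. Hammond, arXiv:1504.05286v5 §4.1,
Definition 4.3 p. 20) a first touch whose nearest pair sits at horizontal distance `3` is merged across a STAGGERED DOUBLE BRICK (contact type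
T2′ of `HexSAWPolygonJunctions.staggeredJoin`): with `t` the contact site of the left polygon `P` (vertical bond `t – u`, `u = t − (0,1)`) and
`c = t + (3,1)`, `d = t + (3,0)` the facing vertical bond of the right polygon `Q`, the joined polygon reads, cyclically,
`u → (P ∖ ut) → t → t+(1,0) → t+(1,1) → t+(2,1) → c → (Q ∖ cd) → d → t+(2,0) → t+(2,−1) → t+(1,−1) → u`, a `2M`-periodic site sequence
(`M = |P| + 3`).  A STAGGERED CUT at `j` (`IsStagCut M v j`, forward reading) records this shape at `v j = u` together with «the block
`v[j, j+M)` lies strictly left of the block `v[j+M, j+2M)` in every row»; `IsStagCut' M v j` records the same junction read BACKWARDS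
(`v j = t + (1,−1)`, right block first).  **The cut is unique** (`isStagCut_unique`) and **a forward and a backward cut never coexist**
(`not_isStagCut'_of_isStagCut`): two decompositions would differ by arcs lying in disjoint row sets, and the rigid nine-site junction then puts two
of its sites on one row in the wrong column order.  Only `2M`-periodicity and (for the mixed statement) «rows move by at most one per step» are used.

## What is proved (namespace `…SAW.HexBW`; all `theorem`s, axioms standard)
* `IsStagCut`, `IsStagCut'` (coordinates); `isStagCut_shift/_add_period`, `isStagCut'_shift/_add_period`;
* `not_isStagCut_of_zero` (a cut at `0` excludes a cut at `1 ≤ j ≤ M`), **`isStagCut_unique`** (`j₁, j₂ < 2M ⇒ j₁ = j₂`);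
* `not_isStagCut'_of_isStagCut_zero`, **`not_isStagCut'_of_isStagCut`** (no backward cut next to a forward cut, `j₁, j₂ < 2M`).
[cite: Hammond2015SAPJoining, Definition 4.3 and §4.2 (arXiv v5 pp. 20–24: junction plaquette; global join plaquettes)]
[cite: Madras1995LatticeAnimalsExponent, §2 (primary, not held by the lane)] [cite: MadrasSlade1993, Theorem 3.2.3 proof (pp. 64–65: decoding a
polygon concatenation)].  Label (expected, as for the one-brick file): NEW-IN-WRITING (modest), technique class Madras join.
-/

noncomputable section

open Literature.Probability.LatticeModels

namespace Literature.Probability.RandomPlanarGeometry.SAW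

namespace HexBW

variable {M : ℕ} {v : ℕ → Site 2}

/-- **Staggered cut, forward reading** of a `2M`-periodic site sequence at `j` (coordinates `0` = column, `1` = row; base `s = v j = u`):
the left block `v[j, j+M)` is `u, (P-arc), t = s+(0,1), s+(1,1), s+(1,2), s+(2,2)`, the right block `v[j+M, j+2M)` is
`c = s+(3,2), (Q-arc), d = s+(3,1), s+(2,1), s+(2,0), s+(1,0)`, and the left block lies strictly left of the right block in every row.
[cite: Hammond2015SAPJoining, Definition 4.3 (arXiv v5 p. 20: the junction plaquette; here a staggered two-brick cluster)] -/
def IsStagCut (M : ℕ) (v : ℕ → Site 2) (j : ℕ) : Prop :=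
  (v (j + M - 4) 0 = v j 0 ∧ v (j + M - 4) 1 = v j 1 + 1) ∧
  (v (j + M - 3) 0 = v j 0 + 1 ∧ v (j + M - 3) 1 = v j 1 + 1) ∧
  (v (j + M - 2) 0 = v j 0 + 1 ∧ v (j + M - 2) 1 = v j 1 + 2) ∧
  (v (j + M - 1) 0 = v j 0 + 2 ∧ v (j + M - 1) 1 = v j 1 + 2) ∧
  (v (j + M) 0 = v j 0 + 3 ∧ v (j + M) 1 = v j 1 + 2) ∧
  (v (j + 2 * M - 4) 0 = v j 0 + 3 ∧ v (j + 2 * M - 4) 1 = v j 1 + 1) ∧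
  (v (j + 2 * M - 3) 0 = v j 0 + 2 ∧ v (j + 2 * M - 3) 1 = v j 1 + 1) ∧
  (v (j + 2 * M - 2) 0 = v j 0 + 2 ∧ v (j + 2 * M - 2) 1 = v j 1) ∧
  (v (j + 2 * M - 1) 0 = v j 0 + 1 ∧ v (j + 2 * M - 1) 1 = v j 1) ∧
  ∀ a b : ℕ, j ≤ a → a < j + M → j + M ≤ b → b < j + 2 * M → v a 1 = v b 1 → v a 0 < v b 0

/-- **Staggered cut, backward reading** at `j` (base `r = v j = t + (1,−1)`): the first block `v[j, j+M)` is
`r, r+(1,0), r+(1,1), d = r+(2,1), (Q-arc), c = r+(2,2)`, the second block `v[j+M, j+2M)` is `r+(1,2), r+(0,2), r+(0,1), t = r+(−1,1), (P-arc),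
u = r+(−1,0)`, and the FIRST block lies strictly RIGHT of the second in every row.
[cite: Hammond2015SAPJoining, Definition 4.3 (arXiv v5 p. 20)] -/
def IsStagCut' (M : ℕ) (v : ℕ → Site 2) (j : ℕ) : Prop :=
  (v (j + 1) 0 = v j 0 + 1 ∧ v (j + 1) 1 = v j 1) ∧
  (v (j + 2) 0 = v j 0 + 1 ∧ v (j + 2) 1 = v j 1 + 1) ∧
  (v (j + 3) 0 = v j 0 + 2 ∧ v (j + 3) 1 = v j 1 + 1) ∧
  (v (j + M - 1) 0 = v j 0 + 2 ∧ v (j + M - 1) 1 = v j 1 + 2) ∧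
  (v (j + M) 0 = v j 0 + 1 ∧ v (j + M) 1 = v j 1 + 2) ∧
  (v (j + M + 1) 0 = v j 0 ∧ v (j + M + 1) 1 = v j 1 + 2) ∧
  (v (j + M + 2) 0 = v j 0 ∧ v (j + M + 2) 1 = v j 1 + 1) ∧
  (v (j + M + 3) 0 + 1 = v j 0 ∧ v (j + M + 3) 1 = v j 1 + 1) ∧
  (v (j + 2 * M - 1) 0 + 1 = v j 0 ∧ v (j + 2 * M - 1) 1 = v j 1) ∧
  ∀ a b : ℕ, j ≤ a → a < j + M → j + M ≤ b → b < j + 2 * M → v a 1 = v b 1 → v b 0 < v a 0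

/-! ### Rows move by at most one: the discrete intermediate value property (local copy) -/

/-- Discrete intermediate value property of the rows, inductive form (local copy of the private step behind
`HexSAWPolygonJoinDecode.exists_row_eq'`, so that this file imports only `SAWBrickWallHex`). [folklore] -/
private theorem exists_row_eq_aux (hrow : ∀ i, v (i + 1) 1 ≤ v i 1 + 1 ∧ v i 1 ≤ v (i + 1) 1 + 1) (a : ℕ) :
    ∀ (n : ℕ) {y : ℤ}, (v a 1 ≤ y ∧ y ≤ v (a + n) 1) ∨ (v (a + n) 1 ≤ y ∧ y ≤ v a 1) →
      ∃ c, a ≤ c ∧ c ≤ a + n ∧ v c 1 = y := by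
  intro n
  induction n with
  | zero =>
    intro y hy
    simp only [Nat.add_zero] at hy
    exact ⟨a, le_rfl, by omega, by omega⟩
  | succ n ih =>
    intro y hy
    simp only [← Nat.add_assoc] at hy ⊢
    have hs := hrow (a + n)
    by_cases h : (v a 1 ≤ y ∧ y ≤ v (a + n) 1) ∨ (v (a + n) 1 ≤ y ∧ y ≤ v a 1)
    · obtain ⟨c, hc1, hc2, hc3⟩ := ih h
      exact ⟨c, hc1, by omega, hc3⟩
    · exact ⟨a + n + 1, by omega, le_rfl, by omega⟩

/-- Discrete intermediate value property: every row between the rows of `v a` and `v c` (`a ≤ c`) is attained in between (local restatement of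
`HexSAWPolygonJoinDecode.exists_row_eq'`; private). [folklore] -/
private theorem exists_row_eq_loc (hrow : ∀ i, v (i + 1) 1 ≤ v i 1 + 1 ∧ v i 1 ≤ v (i + 1) 1 + 1) {a c : ℕ} (hac : a ≤ c) {y : ℤ}
    (hy : (v a 1 ≤ y ∧ y ≤ v c 1) ∨ (v c 1 ≤ y ∧ y ≤ v a 1)) : ∃ b, a ≤ b ∧ b ≤ c ∧ v b 1 = y := by
  obtain ⟨n, rfl⟩ := Nat.exists_eq_add_of_le hac
  exact exists_row_eq_aux hrow a n hy

/-! ### Symmetries of the two cut predicates -/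

/-- Re-indexing: a forward cut of `v` at `c + j` is a forward cut of `v (· + c)` at `j`. [cite: Hammond2015SAPJoining, Definition 4.3 (arXiv v5 p. 20)] -/
theorem isStagCut_shift {c j : ℕ} (hM : 4 ≤ M) (h : IsStagCut M v (c + j)) : IsStagCut M (fun i => v (i + c)) j := by
  obtain ⟨⟨a0, a1⟩, ⟨b0, b1⟩, ⟨c0, c1⟩, ⟨d0, d1⟩, ⟨e0, e1⟩, ⟨f0, f1⟩, ⟨g0, g1⟩, ⟨h0, h1⟩, ⟨i0, i1⟩, sep⟩ := h
  have E : ∀ k l : ℕ, l = c + k → v (k + c) = v l := fun k l hl => by rw [hl, Nat.add_comm]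
  rw [IsStagCut, E (j + M - 4) (c + j + M - 4) (by omega), E (j + M - 3) (c + j + M - 3) (by omega), E (j + M - 2) (c + j + M - 2) (by omega),
    E (j + M - 1) (c + j + M - 1) (by omega), E (j + M) (c + j + M) (by omega), E (j + 2 * M - 4) (c + j + 2 * M - 4) (by omega),
    E (j + 2 * M - 3) (c + j + 2 * M - 3) (by omega), E (j + 2 * M - 2) (c + j + 2 * M - 2) (by omega),
    E (j + 2 * M - 1) (c + j + 2 * M - 1) (by omega), E j (c + j) rfl]
  refine ⟨⟨a0, a1⟩, ⟨b0, b1⟩, ⟨c0, c1⟩, ⟨d0, d1⟩, ⟨e0, e1⟩, ⟨f0, f1⟩, ⟨g0, g1⟩, ⟨h0, h1⟩, ⟨i0, i1⟩, fun a b ha1 ha2 hb1 hb2 hr => ?_⟩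
  exact sep (a + c) (b + c) (by omega) (by omega) (by omega) (by omega) hr

/-- Periodicity: a forward cut at `j` is a forward cut at `j + 2M`. [cite: Hammond2015SAPJoining, Definition 4.3 (arXiv v5 p. 20)] -/
theorem isStagCut_add_period {j : ℕ} (hM : 4 ≤ M) (hper : ∀ i, v (i + 2 * M) = v i) (h : IsStagCut M v j) :
    IsStagCut M v (j + 2 * M) := by
  obtain ⟨⟨a0, a1⟩, ⟨b0, b1⟩, ⟨c0, c1⟩, ⟨d0, d1⟩, ⟨e0, e1⟩, ⟨f0, f1⟩, ⟨g0, g1⟩, ⟨h0, h1⟩, ⟨i0, i1⟩, sep⟩ := h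
  have E : ∀ i k : ℕ, k = i + 2 * M → v k = v i := fun i k hk => by rw [hk, hper]
  rw [IsStagCut, E (j + M - 4) (j + 2 * M + M - 4) (by omega), E (j + M - 3) (j + 2 * M + M - 3) (by omega),
    E (j + M - 2) (j + 2 * M + M - 2) (by omega), E (j + M - 1) (j + 2 * M + M - 1) (by omega), E (j + M) (j + 2 * M + M) (by omega),
    E (j + 2 * M - 4) (j + 2 * M + 2 * M - 4) (by omega), E (j + 2 * M - 3) (j + 2 * M + 2 * M - 3) (by omega),
    E (j + 2 * M - 2) (j + 2 * M + 2 * M - 2) (by omega), E (j + 2 * M - 1) (j + 2 * M + 2 * M - 1) (by omega), E j (j + 2 * M) rfl]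
  refine ⟨⟨a0, a1⟩, ⟨b0, b1⟩, ⟨c0, c1⟩, ⟨d0, d1⟩, ⟨e0, e1⟩, ⟨f0, f1⟩, ⟨g0, g1⟩, ⟨h0, h1⟩, ⟨i0, i1⟩, fun a b ha1 ha2 hb1 hb2 hr => ?_⟩
  have ha := E (a - 2 * M) a (by omega)
  have hb := E (b - 2 * M) b (by omega)
  rw [ha, hb] at hr ⊢
  exact sep _ _ (by omega) (by omega) (by omega) (by omega) hr

/-- Re-indexing for the backward cut. [cite: Hammond2015SAPJoining, Definition 4.3 (arXiv v5 p. 20)] -/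
theorem isStagCut'_shift {c j : ℕ} (hM : 4 ≤ M) (h : IsStagCut' M v (c + j)) : IsStagCut' M (fun i => v (i + c)) j := by
  obtain ⟨⟨a0, a1⟩, ⟨b0, b1⟩, ⟨c0, c1⟩, ⟨d0, d1⟩, ⟨e0, e1⟩, ⟨f0, f1⟩, ⟨g0, g1⟩, ⟨h0, h1⟩, ⟨i0, i1⟩, sep⟩ := h
  have E : ∀ k l : ℕ, l = c + k → v (k + c) = v l := fun k l hl => by rw [hl, Nat.add_comm]
  rw [IsStagCut', E (j + 1) (c + j + 1) (by omega), E (j + 2) (c + j + 2) (by omega), E (j + 3) (c + j + 3) (by omega),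
    E (j + M - 1) (c + j + M - 1) (by omega), E (j + M) (c + j + M) (by omega), E (j + M + 1) (c + j + M + 1) (by omega),
    E (j + M + 2) (c + j + M + 2) (by omega), E (j + M + 3) (c + j + M + 3) (by omega),
    E (j + 2 * M - 1) (c + j + 2 * M - 1) (by omega), E j (c + j) rfl]
  refine ⟨⟨a0, a1⟩, ⟨b0, b1⟩, ⟨c0, c1⟩, ⟨d0, d1⟩, ⟨e0, e1⟩, ⟨f0, f1⟩, ⟨g0, g1⟩, ⟨h0, h1⟩, ⟨i0, i1⟩, fun a b ha1 ha2 hb1 hb2 hr => ?_⟩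
  exact sep (a + c) (b + c) (by omega) (by omega) (by omega) (by omega) hr

/-- Periodicity for the backward cut. [cite: Hammond2015SAPJoining, Definition 4.3 (arXiv v5 p. 20)] -/
theorem isStagCut'_add_period {j : ℕ} (hM : 4 ≤ M) (hper : ∀ i, v (i + 2 * M) = v i) (h : IsStagCut' M v j) :
    IsStagCut' M v (j + 2 * M) := by
  obtain ⟨⟨a0, a1⟩, ⟨b0, b1⟩, ⟨c0, c1⟩, ⟨d0, d1⟩, ⟨e0, e1⟩, ⟨f0, f1⟩, ⟨g0, g1⟩, ⟨h0, h1⟩, ⟨i0, i1⟩, sep⟩ := h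
  have E : ∀ i k : ℕ, k = i + 2 * M → v k = v i := fun i k hk => by rw [hk, hper]
  rw [IsStagCut', E (j + 1) (j + 2 * M + 1) (by omega), E (j + 2) (j + 2 * M + 2) (by omega), E (j + 3) (j + 2 * M + 3) (by omega),
    E (j + M - 1) (j + 2 * M + M - 1) (by omega), E (j + M) (j + 2 * M + M) (by omega), E (j + M + 1) (j + 2 * M + M + 1) (by omega),
    E (j + M + 2) (j + 2 * M + M + 2) (by omega), E (j + M + 3) (j + 2 * M + M + 3) (by omega),
    E (j + 2 * M - 1) (j + 2 * M + 2 * M - 1) (by omega), E j (j + 2 * M) rfl]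
  refine ⟨⟨a0, a1⟩, ⟨b0, b1⟩, ⟨c0, c1⟩, ⟨d0, d1⟩, ⟨e0, e1⟩, ⟨f0, f1⟩, ⟨g0, g1⟩, ⟨h0, h1⟩, ⟨i0, i1⟩, fun a b ha1 ha2 hb1 hb2 hr => ?_⟩
  have ha := E (a - 2 * M) a (by omega)
  have hb := E (b - 2 * M) b (by omega)
  rw [ha, hb] at hr ⊢
  exact sep _ _ (by omega) (by omega) (by omega) (by omega) hr

/-! ### Uniqueness of the forward cut -/

/-- Core case: a forward cut at `0` excludes a forward cut at any `1 ≤ j ≤ M` (no row hypothesis needed: the rigid junction does it).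
[cite: Hammond2015SAPJoining, §4.2 (arXiv v5 pp. 20–24: global join plaquettes; here unique, for row-separated joins)] -/
theorem not_isStagCut_of_zero (hM : 4 ≤ M) (hper : ∀ i, v (i + 2 * M) = v i) (h0 : IsStagCut M v 0) {j : ℕ} (hj1 : 1 ≤ j)
    (hjM : j ≤ M) (hj : IsStagCut M v j) : False := by
  obtain ⟨⟨a0, a1⟩, ⟨b0, b1⟩, ⟨c0, c1⟩, ⟨d0, d1⟩, ⟨e0, e1⟩, ⟨f0, f1⟩, ⟨g0, g1⟩, ⟨h0, h1⟩, ⟨i0, i1⟩, sep0⟩ := h0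
  obtain ⟨⟨aj0, aj1⟩, ⟨bj0, bj1⟩, ⟨cj0, cj1⟩, ⟨dj0, dj1⟩, ⟨ej0, ej1⟩, ⟨fj0, fj1⟩, ⟨gj0, gj1⟩, ⟨hj0, hj1'⟩, ⟨ij0, ij1⟩, sepj⟩ := hj
  simp only [Nat.zero_add] at a0 a1 b0 b1 c0 c1 d0 d1 e0 e1 f0 f1 g0 g1 h0 h1 i0 i1 sep0
  have hp2M : v (2 * M) = v 0 := by simpa using hper 0
  by_cases hjM' : j = M
  · -- blocks swapped: `d₀` (first block of the cut at `M`) and `t₀` (second block) lie on one row in the wrong order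
    subst hjM'
    have e : v (j - 4 + 2 * j) = v (j - 4) := hper _
    have := sepj (2 * j - 4) (j - 4 + 2 * j) (by omega) (by omega) (by omega) (by omega) (by rw [e]; omega)
    rw [e] at this
    omega
  have hjM2 : j ≤ M - 1 := by omega
  -- R1: the arcs `A = [0, j)` and `B = [M, M + j)` share no row
  have R1 : ∀ a, a < j → ∀ b, M ≤ b → b < M + j → v a 1 ≠ v b 1 := by
    intro a ha b hb1 hb2 hr
    have h1 := sep0 a b (Nat.zero_le _) (by omega) (by omega) (by omega) hr
    have hr' : v b 1 = v (a + 2 * M) 1 := by rw [hper]; exact hr.symm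
    have h2 := sepj b (a + 2 * M) (by omega) (by omega) (by omega) (by omega) hr'
    rw [hper] at h2
    omega
  by_cases hj1' : j = 1
  · subst hj1'
    have e1 : 1 + M - 4 = M - 3 := by omega
    have e2 : 1 + M - 3 = M - 2 := by omega
    rw [e1] at aj0 aj1; rw [e2] at bj0 bj1
    omega
  by_cases hj2' : j = 2
  · subst hj2'
    have e1 : 2 + M - 4 = M - 2 := by omega
    have e2 : 2 + M - 2 = M := by omega
    rw [e1] at aj0 aj1; rw [e2] at cj0 cj1
    omega
  by_cases hj3' : j = 3
  · subst hj3'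
    have e1 : 3 + M - 4 = M - 1 := by omega
    have e2 : v (3 + 2 * M - 3) = v 0 := by rw [show 3 + 2 * M - 3 = 0 + 2 * M by omega, hper]
    rw [e1] at aj0 aj1; rw [e2] at gj0 gj1
    omega
  -- `j ≥ 4`: `t_j = v (j+M−4) ∈ B` and `d_j = v (j+2M−4) = v (j−4) ∈ A` lie on the same row
  have hj4 : 4 ≤ j := by omega
  have e : v (j + 2 * M - 4) = v (j - 4) := by rw [show j + 2 * M - 4 = (j - 4) + 2 * M by omega, hper]
  rw [e] at fj1
  exact R1 (j - 4) (by omega) (j + M - 4) (by omega) (by omega) (by omega)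

/-- **The forward staggered cut of a merged honeycomb polygon is unique**: for a `2M`-periodic site sequence, two forward cuts
`j₁, j₂ < 2M` coincide. [cite: Hammond2015SAPJoining, Definition 4.3 and §4.2 (arXiv v5 pp. 20–24)]
[cite: Madras1995LatticeAnimalsExponent, §2] [cite: MadrasSlade1993, Theorem 3.2.3 proof (pp. 64–65)] -/
theorem isStagCut_unique (hM : 4 ≤ M) (hper : ∀ i, v (i + 2 * M) = v i) {j₁ j₂ : ℕ} (hj₁ : j₁ < 2 * M) (hj₂ : j₂ < 2 * M)
    (h₁ : IsStagCut M v j₁) (h₂ : IsStagCut M v j₂) : j₁ = j₂ := by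
  by_contra hne
  have hper' : ∀ a i, (fun i => v (i + a)) (i + 2 * M) = (fun i => v (i + a)) i := fun a i => by
    show v (i + 2 * M + a) = v (i + a)
    rw [show i + 2 * M + a = (i + a) + 2 * M by omega, hper]
  have key : ∀ {a b : ℕ}, a < b → b ≤ a + M → IsStagCut M v a → IsStagCut M v b → False := by
    intro a b hab hbM ha hb
    have h0 : IsStagCut M (fun i => v (i + a)) 0 := isStagCut_shift hM (by simpa using ha)
    have hb' : IsStagCut M (fun i => v (i + a)) (b - a) := isStagCut_shift hM (by rw [Nat.add_sub_cancel' hab.le]; exact hb)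
    exact not_isStagCut_of_zero hM (hper' a) h0 (by omega) (by omega) hb'
  rcases Nat.lt_or_gt_of_ne hne with h | h
  · by_cases hd : j₂ ≤ j₁ + M
    · exact key h hd h₁ h₂
    · exact key (show j₂ < j₁ + 2 * M by omega) (by omega) h₂ (isStagCut_add_period hM hper h₁)
  · by_cases hd : j₁ ≤ j₂ + M
    · exact key h hd h₂ h₁
    · exact key (show j₁ < j₂ + 2 * M by omega) (by omega) h₁ (isStagCut_add_period hM hper h₂)

/-! ### No backward cut next to a forward cut -/

/-- Core case: a forward cut at `0` excludes a backward cut at any `j < 2M` (rows moving by at most one per step).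
[cite: Hammond2015SAPJoining, §4.2 (arXiv v5 pp. 20–24)] -/
theorem not_isStagCut'_of_isStagCut_zero (hM : 4 ≤ M) (hper : ∀ i, v (i + 2 * M) = v i)
    (hrow : ∀ i, v (i + 1) 1 ≤ v i 1 + 1 ∧ v i 1 ≤ v (i + 1) 1 + 1) (h0 : IsStagCut M v 0) {j : ℕ} (hj2 : j < 2 * M)
    (hj : IsStagCut' M v j) : False := by
  obtain ⟨⟨a0, a1⟩, ⟨b0, b1⟩, ⟨c0, c1⟩, ⟨d0, d1⟩, ⟨e0, e1⟩, ⟨f0, f1⟩, ⟨g0, g1⟩, ⟨h0, h1⟩, ⟨i0, i1⟩, sep0⟩ := h0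
  obtain ⟨⟨aj0, aj1⟩, ⟨bj0, bj1⟩, ⟨cj0, cj1⟩, ⟨dj0, dj1⟩, ⟨ej0, ej1⟩, ⟨fj0, fj1⟩, ⟨gj0, gj1⟩, ⟨hj0, hj1⟩, ⟨ij0, ij1⟩, sepj⟩ := hj
  simp only [Nat.zero_add] at a0 a1 b0 b1 c0 c1 d0 d1 e0 e1 f0 f1 g0 g1 h0 h1 i0 i1 sep0
  rcases Nat.lt_or_ge j (M - 3) with hlt | hge
  · -- `j ≤ M − 4`: `t₀ = v (M−4)` (first block of the backward cut) and `d₀ = v (2M−4)` (second block) — wrong order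
    have := sepj (M - 4) (2 * M - 4) (by omega) (by omega) (by omega) (by omega) (by omega)
    omega
  by_cases e3 : j = M - 3
  · subst e3
    have e : M - 3 + 1 = M - 2 := by omega
    rw [e] at aj0 aj1
    omega
  by_cases e2 : j = M - 2
  · subst e2
    have e : M - 2 + 2 = M := by omega
    rw [e] at bj0 bj1
    omega
  by_cases e1 : j = M - 1
  · subst e1
    have e : M - 1 + M - 1 = 2 * M - 2 := by omega
    rw [e] at dj0 dj1
    omega
  by_cases e0 : j = M
  · subst e0
    have e : j + j - 1 = 2 * j - 1 := by omega
    rw [e] at dj0 dj1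
    omega
  -- `j = M + k`, `1 ≤ k ≤ M − 1`
  obtain ⟨k, rfl⟩ : ∃ k, j = M + k := ⟨j - M, by omega⟩
  have hk1 : 1 ≤ k := by omega
  have hkM : k ≤ M - 1 := by omega
  -- R1: `A = [0, k)` and `B = [M, M + k)` share no row
  have R1 : ∀ a, a < k → ∀ b, M ≤ b → b < M + k → v a 1 ≠ v b 1 := by
    intro a ha b hb1 hb2 hr
    have h1 := sep0 a b (Nat.zero_le _) (by omega) (by omega) (by omega) hr
    have hr' : v (a + 2 * M) 1 = v (b + 2 * M) 1 := by rw [hper, hper]; exact hr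
    have h2 := sepj (a + 2 * M) (b + 2 * M) (by omega) (by omega) (by omega) (by omega) hr'
    rw [hper, hper] at h2
    omega
  -- rows of `A` are `≤ y₀ + 1`, rows of `B` are `≥ y₀ + 1` (`y₀ = v 0 1`; `v M 1 = y₀ + 2`)
  have hA : ∀ a, a < k → v a 1 ≤ v 0 1 + 1 := by
    intro a ha
    by_contra hcon
    push Not at hcon
    obtain ⟨c, -, hc2, hc3⟩ := exists_row_eq_loc hrow (Nat.zero_le a) (y := v M 1) (Or.inl ⟨by omega, by omega⟩)
    exact R1 c (by omega) M le_rfl (by omega) hc3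
  have hB : ∀ b, M ≤ b → b < M + k → v 0 1 + 1 ≤ v b 1 := by
    intro b hb1 hb2
    by_contra hcon
    push Not at hcon
    obtain ⟨c, hc1, hc2, hc3⟩ := exists_row_eq_loc hrow hb1 (y := v 0 1) (Or.inr ⟨by omega, by omega⟩)
    exact R1 0 (by omega) c hc1 (by omega) hc3.symm
  -- `u' = v (j+2M−1) = v (M+k−1) ∈ B` has row `r₁`, `c' = v (j+M−1) = v (k−1) ∈ A` has row `r₁ + 2`
  have eu : v (M + k + 2 * M - 1) = v (M + k - 1) := by rw [show M + k + 2 * M - 1 = (M + k - 1) + 2 * M by omega, hper]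
  have ec : v (M + k + M - 1) = v (k - 1) := by rw [show M + k + M - 1 = (k - 1) + 2 * M by omega, hper]
  rw [eu] at ij1
  rw [ec] at dj1
  have h1 := hB (M + k - 1) (by omega) (by omega)
  have h2 := hA (k - 1) (by omega)
  -- and `v (M + k) 1`, the base row `r₁`, ties them: `ij1 : v (M+k−1) 1 = r₁`, `dj1 : v (k−1) 1 = r₁ + 2`
  omega

/-- **A forward and a backward staggered cut never coexist** on a `2M`-periodic site sequence whose rows move by at most one per step
(`j₁, j₂ < 2M`). [cite: Hammond2015SAPJoining, Definition 4.3 and §4.2 (arXiv v5 pp. 20–24)] [cite: Madras1995LatticeAnimalsExponent, §2] -/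
theorem not_isStagCut'_of_isStagCut (hM : 4 ≤ M) (hper : ∀ i, v (i + 2 * M) = v i)
    (hrow : ∀ i, v (i + 1) 1 ≤ v i 1 + 1 ∧ v i 1 ≤ v (i + 1) 1 + 1) {j₁ j₂ : ℕ} (hj₁ : j₁ < 2 * M) (hj₂ : j₂ < 2 * M)
    (h₁ : IsStagCut M v j₁) (h₂ : IsStagCut' M v j₂) : False := by
  have hper' : ∀ i, (fun i => v (i + j₁)) (i + 2 * M) = (fun i => v (i + j₁)) i := fun i => by
    show v (i + 2 * M + j₁) = v (i + j₁)
    rw [show i + 2 * M + j₁ = (i + j₁) + 2 * M by omega, hper]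
  have hrow' : ∀ i, (fun i => v (i + j₁)) (i + 1) 1 ≤ (fun i => v (i + j₁)) i 1 + 1 ∧
      (fun i => v (i + j₁)) i 1 ≤ (fun i => v (i + j₁)) (i + 1) 1 + 1 := fun i => by
    show v (i + 1 + j₁) 1 ≤ v (i + j₁) 1 + 1 ∧ v (i + j₁) 1 ≤ v (i + 1 + j₁) 1 + 1
    rw [show i + 1 + j₁ = (i + j₁) + 1 by omega]; exact hrow _
  have h0 : IsStagCut M (fun i => v (i + j₁)) 0 := isStagCut_shift hM (by simpa using h₁)
  rcases Nat.lt_or_ge j₂ j₁ with hlt | hge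
  · have h₂' := isStagCut'_add_period hM hper h₂
    have hb : IsStagCut' M (fun i => v (i + j₁)) (j₂ + 2 * M - j₁) :=
      isStagCut'_shift hM (by rw [show j₁ + (j₂ + 2 * M - j₁) = j₂ + 2 * M by omega]; exact h₂')
    exact not_isStagCut'_of_isStagCut_zero hM hper' hrow' h0 (by omega) hb
  · have hb : IsStagCut' M (fun i => v (i + j₁)) (j₂ - j₁) :=
      isStagCut'_shift hM (by rw [Nat.add_sub_cancel' hge]; exact h₂)
    exact not_isStagCut'_of_isStagCut_zero hM hper' hrow' h0 (by omega) hb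

end HexBW

end Literature.Probability.RandomPlanarGeometry.SAW
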